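import Summits.BirchSwinnertonDyer.BirchSwinnertonDyer.Theorems.ThetaPartnerAtTwoMazurTateCongruenceAtTwoRDepletionPrimitive
import HarnessLib

/-!
# Crux `MazurTateCongruenceAtTwoTop` (stmt-BirchSwinnertonDyer-25797 = 21416), line `symbol` v4: the PLUMBING STUB
# `stub_depletionPrimitive_of_ihara` — (IH₂-core) «Ihara mod 2, symbol form» ⟹ (DP₂) «depletion preserves primitivity»
# (lead prover bsd-wall-tp2-p1 g11; `--supports stmt-BirchSwinnertonDyer-25797`; proves the registered stub BY NAME AND SIGNATURE)

HONEST FRAMING. THEOREMS ONLY. (IH₂-core) is a HYPOTHESIS (the cite-grade stub `stub_iharaSymbolModTwo` of skeleton `symbol` v4);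
nothing about its truth is asserted; BSD is not proved by any of this. With this file the registered skeleton's only non-PUB input is
(IH₂-core).

PROOF (memo `Cruxes/MazurTateCongruenceAtTwoTop/K1ROW-LEAD-g11.md` §3–4). Induction on the depletion set `T ⊆ S₀`: the doubled
Néron-normalised expanded `T`-depleted plus table `Φ_T = 2ϖ·Ψ^T_E` has a `2`-adic unit value. `T = ∅`: the undepleted hypothesis.
`T → T ∪ {v₀}`: the table splits at `v₀` (§1 `expandedTable_insert`: `Ψ^{T∪v₀}(x) = Σ_{j<3} c_j Ψ^T(ℓ^j x)`, `c₀ = 1`, `‖c_j‖ ≤ 1`); if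
`Φ_{T∪v₀}` had no unit value it would be everywhere in `𝔪` (it is integral), so by the landed translation lemma
`norm_sub_lt_one_of_depletion` `Φ_T` is `ℤ[1/ℓ]`-periodic mod `𝔪`; `Φ_T` is `1`-periodic, even, a `Γ₀(N_E·∏_T ℓ²)`-symbol function,
integral and EXACTLY Hecke for `a_q(E)` off the level (route RTT's `depletedCurveSymbol_*`, `…PlusLineGlue`), so (IH₂-core) forces
`Φ_T ≡ 0 (mod 𝔪)` — contradicting the induction hypothesis.

References: [Ribet1984ICM] Thm. 4.1–4.3; [Serre1970SL2]; [GreenbergVatsal2000] §1 (8), §3 (13); [Manin1972] Thm. 1.9.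
-/

-- justification: the `Summit.BirchSwinnertonDyer.BirchSwinnertonDyer.…` path repeats a component (route-file convention)
set_option linter.dupNamespace false
set_option autoImplicit false

noncomputable section

open scoped Classical MatrixGroups ModularForm

open CongruenceSubgroup Polynomial WeierstrassCurve NumberField IsDedekindDomain
  Literature.NumberTheory.IwasawaTheory Literature.NumberTheory.EllipticCurves Literature.NumberTheory.EllipticCurves.ModularForms
  Literature.NumberTheory.EllipticCurves.Rank1Residual Literature.NumberTheory.EllipticCurves.GreenbergVatsal2000
  Summit.BirchSwinnertonDyer.Rank1Residual.Supersingular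
  Summit.BirchSwinnertonDyer.BirchSwinnertonDyer.Theorems.ThetaLayerLambdaCongruenceAtTwo

namespace Summit.BirchSwinnertonDyer.BirchSwinnertonDyer.Theorems.MazurTateCongruenceAtTwoR

/-! ## §1. Splitting the expanded table at one more place (bookkeeping over `Fintype.piFinset`) -/

section Split

variable {α : Type*} [DecidableEq α]

/-- `∏` over the subtype of `insert v T` = the `v`-factor times `∏` over the subtype of `T` (`v ∉ T`). [folklore] -/
theorem prod_coe_insert {M : Type*} [CommMonoid M] {v : α} {T : Finset α} (hv : v ∉ T) (H : ↥(insert v T) → M) :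
    ∏ w : ↥(insert v T), H w =
      H ⟨v, Finset.mem_insert_self v T⟩ * ∏ w : ↥T, H ⟨(w : α), Finset.mem_insert_of_mem w.2⟩ := by
  rw [Finset.univ_eq_attach, Finset.attach_insert, Finset.prod_insert, Finset.prod_image, Finset.univ_eq_attach]
  · rintro ⟨x, hx⟩ - ⟨y, hy⟩ - h
    exact Subtype.ext (by simpa using h)
  · intro h
    obtain ⟨w, -, hw⟩ := Finset.mem_image.mp h
    rw [Subtype.ext_iff] at hw
    have hw' : (w : α) = v := hw
    exact hv (hw' ▸ w.2)

/-- **One-place splitting of the expanded depleted table.** For `v ∉ T`, weights `G`, bases `L`, a table `φ` and a point `x`: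
`Σ_{k ∈ {0,1,2}^{T ∪ v}} (∏_w G_w(k_w))·φ(x·∏_w L_w^{k_w}) = Σ_{j<3} G_v(j) · Σ_{k' ∈ {0,1,2}^T} (∏_w G_w(k'_w))·φ((L_v^j·x)·∏_w L_w^{k'_w})`
(re-indexing `k ↦ (k_v, k|_T)`). [cite: GreenbergVatsal2000, §1 p. 9 (display (8))] -/
theorem expandedTable_insert {K : Type*} [CommRing K] {v : α} {T : Finset α} (hv : v ∉ T) (G : α → ℕ → K) (L : α → ℕ)
    (φ : ℚ → K) (x : ℚ) :
    (∑ k ∈ Fintype.piFinset (fun _ : ↥(insert v T) ↦ Finset.range 3),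
        (∏ w : ↥(insert v T), G (w : α) (k w)) * φ (x * ((∏ w : ↥(insert v T), L (w : α) ^ (k w) : ℕ) : ℚ))) =
      ∑ j ∈ Finset.range 3, G v j *
        ∑ k ∈ Fintype.piFinset (fun _ : ↥T ↦ Finset.range 3),
          (∏ w : ↥T, G (w : α) (k w)) * φ (((L v : ℚ) ^ j * x) * ((∏ w : ↥T, L (w : α) ^ (k w) : ℕ) : ℚ)) := by
  have hmemv : v ∈ insert v T := Finset.mem_insert_self v T
  -- the right-hand side as ONE sum over `range 3 ×ˢ {0,1,2}^T`
  have hR : (∑ j ∈ Finset.range 3, G v j *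
        ∑ k ∈ Fintype.piFinset (fun _ : ↥T ↦ Finset.range 3),
          (∏ w : ↥T, G (w : α) (k w)) * φ (((L v : ℚ) ^ j * x) * ((∏ w : ↥T, L (w : α) ^ (k w) : ℕ) : ℚ))) =
      ∑ p ∈ Finset.range 3 ×ˢ Fintype.piFinset (fun _ : ↥T ↦ Finset.range 3),
        G v p.1 * ((∏ w : ↥T, G (w : α) (p.2 w)) * φ (((L v : ℚ) ^ p.1 * x) * ((∏ w : ↥T, L (w : α) ^ (p.2 w) : ℕ) : ℚ))) := by
    rw [Finset.sum_product]
    refine Finset.sum_congr rfl fun j _ ↦ ?_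
    rw [Finset.mul_sum]
  rw [hR]
  refine Finset.sum_nbij'
    (fun k ↦ (k ⟨v, hmemv⟩, fun w ↦ k ⟨(w : α), Finset.mem_insert_of_mem w.2⟩))
    (fun p w ↦ if h : (w : α) = v then p.1 else p.2 ⟨(w : α), (Finset.mem_insert.mp w.2).resolve_left h⟩)
    ?_ ?_ ?_ ?_ ?_
  · -- lands in the product set
    intro k hk
    rw [Fintype.mem_piFinset] at hk
    simp only [Finset.mem_product, Fintype.mem_piFinset]
    exact ⟨hk _, fun w ↦ hk _⟩
  · intro p hp
    simp only [Finset.mem_product, Fintype.mem_piFinset] at hp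
    rw [Fintype.mem_piFinset]
    intro w
    by_cases h : (w : α) = v
    · simp only [h, dif_pos]; exact hp.1
    · simp only [h, dif_neg, not_false_eq_true]; exact hp.2 _
  · -- left inverse
    intro k _
    funext w
    by_cases h : (w : α) = v
    · have hw : w = ⟨v, hmemv⟩ := Subtype.ext h
      subst hw
      simp
    · simp [h]
  · -- right inverse
    rintro ⟨j, k⟩ hp
    simp only [Finset.mem_product, Fintype.mem_piFinset] at hp
    have hne : ∀ w : ↥T, (w : α) ≠ v := fun w h ↦ hv (h ▸ w.2)
    ext
    · simp
    · simp [hne]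
  · -- the summands agree
    intro k _
    have h1 := prod_coe_insert hv (fun w ↦ G (w : α) (k w))
    have h2 := prod_coe_insert hv (fun w ↦ L (w : α) ^ (k w))
    dsimp only at h1 h2 ⊢
    have harg : x * ((L v ^ k ⟨v, hmemv⟩ * ∏ w : ↥T, L (w : α) ^ k ⟨(w : α), Finset.mem_insert_of_mem w.2⟩ : ℕ) : ℚ) =
        (L v : ℚ) ^ k ⟨v, hmemv⟩ * x * ((∏ w : ↥T, L (w : α) ^ k ⟨(w : α), Finset.mem_insert_of_mem w.2⟩ : ℕ) : ℚ) := by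
      push_cast; ring
    rw [h1, h2, harg]
    ring

end Split

/-! ## §2. Small facts: empty table, weights, translation lemma with a natural `ℓ` -/

section Small

variable (E : WeierstrassCurve ℚ) [E.IsElliptic] [E.IsGloballyMinimal] {N : ℕ} (f : CuspForm (Gamma0 N) 2)

omit [E.IsElliptic] [E.IsGloballyMinimal] in
/-- The expanded table over the EMPTY depletion set is the plus symbol itself. [folklore] -/
theorem expandedTable_empty (x : ℚ) :
    (∑ k ∈ Fintype.piFinset (fun _ : (∅ : Finset (HeightOneSpectrum (𝓞 ℚ))) ↦ Finset.range 3), (∏ v : (∅ : Finset (HeightOneSpectrum (𝓞 ℚ))), ((E.localPolynomialAt (v : HeightOneSpectrum (𝓞 ℚ))).map (Int.castRingHom (PadicAlgCl 2))).coeff (k v) * ((Rat.HeightOneSpectrum.natGenerator (v : HeightOneSpectrum (𝓞 ℚ)) : PadicAlgCl 2)⁻¹) ^ (k v)) * algebraMap ℚ (PadicAlgCl 2) (ratPlusSymbol f (x * ((∏ v : (∅ : Finset (HeightOneSpectrum (𝓞 ℚ))), Rat.HeightOneSpectrum.natGenerator (v : HeightOneSpectrum (𝓞 ℚ)) ^ (k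 v) : ℕ) : ℚ)))) =
      algebraMap ℚ (PadicAlgCl 2) (ratPlusSymbol f x) := by
  have huniv : Fintype.piFinset (fun _ : ↥(∅ : Finset (HeightOneSpectrum (𝓞 ℚ))) ↦ Finset.range 3) = Finset.univ :=
    Finset.eq_univ_of_forall fun k ↦ Fintype.mem_piFinset.mpr fun a ↦ isEmptyElim a
  rw [huniv, Fintype.sum_unique]
  simp

omit [E.IsElliptic] [E.IsGloballyMinimal] in
/-- The depletion weight at `j = 0` is `1` (`P_v(0) = 1`). [cite: GreenbergVatsal2000, §2 Prop. (2.4)] -/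
theorem depletionWeight_zero (v₀ : HeightOneSpectrum (𝓞 ℚ)) : (((E.localPolynomialAt v₀).map (Int.castRingHom (PadicAlgCl 2))).coeff 0 * ((Rat.HeightOneSpectrum.natGenerator v₀ : PadicAlgCl 2)⁻¹) ^ 0) = 1 := by
  rw [Polynomial.coeff_map, E.coeff_zero_localPolynomialAt v₀, map_one, pow_zero, mul_one]

omit [E.IsElliptic] [E.IsGloballyMinimal] in
/-- The depletion weights at an ODD place are `2`-integral. [cite: GreenbergVatsal2000, §2 Prop. (2.4)] -/
theorem norm_depletionWeight_le_one {v₀ : HeightOneSpectrum (𝓞 ℚ)} (h2 : ((2 : ℕ) : 𝓞 ℚ) ∉ v₀.asIdeal) (j : ℕ) :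
    ‖(((E.localPolynomialAt v₀).map (Int.castRingHom (PadicAlgCl 2))).coeff j * ((Rat.HeightOneSpectrum.natGenerator v₀ : PadicAlgCl 2)⁻¹) ^ j)‖ ≤ 1 := by
  rw [norm_mul, norm_pow, norm_inv, norm_natCast_padicAlgCl_two_eq_one (not_two_dvd_natGenerator h2), inv_one, one_pow, mul_one,
    Polynomial.coeff_map, eq_intCast, ← map_intCast (algebraMap ℚ_[2] (PadicAlgCl 2)), PadicAlgCl.norm_extends]
  exact Padic.norm_int_le_one _

/-- The translation lemma `norm_sub_lt_one_of_depletion` with a natural-number base `ℓ`. [cite: Ribet1984ICM, Thm. 4.1 (proof)] -/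
theorem norm_sub_lt_one_of_depletion_nat {K : Type*} [NormedField K] [IsUltrametricDist K] {Φ : ℚ → K}
    (h1 : ∀ (r : ℚ) (z : ℤ), Φ (r + z) = Φ r) {c₁ c₂ : K} (hc₁ : ‖c₁‖ ≤ 1) (hc₂ : ‖c₂‖ ≤ 1) {ℓ : ℕ} (hℓ : ℓ ≠ 0)
    (hD : ∀ r : ℚ, ‖Φ r + c₁ * Φ ((ℓ : ℚ) * r) + c₂ * Φ ((ℓ : ℚ) ^ 2 * r)‖ < 1) (r : ℚ) (j : ℤ) (n : ℕ) :
    ‖Φ (r + j / (ℓ : ℚ) ^ n) - Φ r‖ < 1 := by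
  have h := norm_sub_lt_one_of_depletion h1 hc₁ hc₂ (ℓ := (ℓ : ℤ)) (Int.natCast_ne_zero.mpr hℓ)
    (fun r ↦ by simpa only [Int.cast_natCast] using hD r) n r j
  simpa only [Int.cast_natCast] using h

end Small

/-! ## §3. The registered stub `stub_depletionPrimitive_of_ihara` of skeleton `symbol` v4: (IH₂-core) ⟹ (DP₂) -/

section Stub

/-- **`stub_depletionPrimitive_of_ihara` (skeleton `symbol` v4, crux 25797) — (IH₂-core) ⟹ (DP₂).** Granted «Ihara's lemma mod `2` in
symbol form» (IH₂-core: a `1`-periodic even `Γ₀(N')`-symbol function `ℚ → ℚ̄₂`, integral and Hecke-congruent to `a_q(W)` off `2N'ℓ` for a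
curve `W` good supersingular at `2`, which is `ℤ[1/ℓ]`-translation invariant mod `𝔪`, vanishes mod `𝔪`), depletion at odd places preserves
primitivity: for `E` good supersingular at `2` with `a₂ = 0`, newform `f`, Néron ratio `ϖ`, admissible `S₀`, if `2ϖ[·]⁺_f` has a `2`-adic unit
value on `ℚ` then so has the doubled Néron-normalised expanded `S₀`-depleted plus table. Induction on the depletion set (module docstring).
[cite: Ribet1984ICM, Thm. 4.3] [cite: GreenbergVatsal2000, §1 (8) and §3 (13)] [cite: Manin1972, Thm. 1.9] -/
theorem stub_depletionPrimitive_of_ihara :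
    realPeriodRat_eq_unit_mul_plusPeriod_two → (∀ (W : WeierstrassCurve ℚ) [W.IsElliptic] [W.IsGloballyMinimal], GoodSS W 2 → ∀ (N' : ℕ), Odd N' →
      (∀ v : IsDedekindDomain.HeightOneSpectrum (NumberField.RingOfIntegers ℚ), ¬ ((Rat.HeightOneSpectrum.primesEquiv v : ℕ) ∣ 2 * N') → W.HasGoodReductionAt v) →
      ∀ (ℓ : ℕ), ℓ.Prime → ℓ ≠ 2 → ∀ (Φ : ℚ → PadicAlgCl 2),
      (∀ (r : ℚ) (z : ℤ), Φ (r + z) = Φ r) → (∀ r : ℚ, Φ (-r) = Φ r) → (∀ (γ : CongruenceSubgroup.Gamma0 (N')) (r : ℚ), ((γ : SL(2, ℤ)) 1 0 : ℚ) * r + ((γ : SL(2, ℤ)) 1 1 : ℚ) ≠ 0 → Φ ((((γ : SL(2, ℤ)) 0 0 : ℚ) * r + ((γ : SL(2, ℤ)) 0 1 : ℚ)) / (((γ : SL(2, ℤ)) 1 0 : ℚ) * r + ((γ : SL(2, ℤ)) 1 1 : ℚ))) = (if ((γ : SL(2, ℤ)) 1 0) = 0 then 0 else Φ ((((γ : SL(2,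 ℤ)) 0 0 : ℚ)) / (((γ : SL(2, ℤ)) 1 0 : ℚ)))) + Φ r) →
      (∀ r : ℚ, ‖Φ r‖ ≤ 1) →
      (∀ q : ℕ, q.Prime → ¬ q ∣ 2 * N' * ℓ → ∀ r : ℚ, ‖(∑ j : Fin q, Φ ((r + j) / q)) + Φ (q * r) - (W.LFunction q : PadicAlgCl 2) * Φ r‖ < 1) →
      (∀ (r : ℚ) (j : ℤ) (n : ℕ), ‖Φ (r + j / (ℓ : ℚ) ^ n) - Φ r‖ < 1) →
      ∀ r : ℚ, ‖Φ r‖ < 1) →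
      ∀ (E : WeierstrassCurve ℚ) [E.IsElliptic] [E.IsGloballyMinimal], GoodSS E 2 → E.frobeniusTrace 2 = 0 →
      ∀ [NeZero (E.conductorNorm ℤ)] (f : CuspForm (Gamma0 (E.conductorNorm ℤ)) 2), IsNewformOf E f →
      ∀ (ϖ : ℚ), (ϖ : ℝ) * E.realPeriodRat = plusPeriod f →
      ∀ (S₀ : Finset (HeightOneSpectrum (𝓞 ℚ))), (∀ v ∈ S₀, ((2 : ℕ) : 𝓞 ℚ) ∉ v.asIdeal) →
        (∀ v : HeightOneSpectrum (𝓞 ℚ), ¬ E.HasGoodReductionAt v → v ∈ S₀) →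
      (∃ r : ℚ, ‖algebraMap ℚ (PadicAlgCl 2) (2 * ϖ) * algebraMap ℚ (PadicAlgCl 2) (ratPlusSymbol f r)‖ = 1) →
      ∃ x₀ : ℚ, ‖algebraMap ℚ (PadicAlgCl 2) (2 * ϖ) * (∑ k ∈ Fintype.piFinset (fun _ : S₀ ↦ Finset.range 3), (∏ v : S₀, ((E.localPolynomialAt (v : HeightOneSpectrum (𝓞 ℚ))).map (Int.castRingHom (PadicAlgCl 2))).coeff (k v) * ((Rat.HeightOneSpectrum.natGenerator (v : HeightOneSpectrum (𝓞 ℚ)) : PadicAlgCl 2)⁻¹) ^ (k v)) * algebraMap ℚ (PadicAlgCl 2) (ratPlusSymbol f (x₀ * ((∏ v : S₀, Rat.HeightOneSpectrum.natGenerator (v : HeightOneSpectrum (𝓞 ℚ)) ^ (k v) : ℕ) : ℚ))))‖ = 1 := by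
  intro h2 hIH E _ _ hss ha _ f hf ϖ hϖ S₀ hS2 hSE hund
  set c : PadicAlgCl 2 := algebraMap ℚ (PadicAlgCl 2) (2 * ϖ) with hcdef
  -- `‖c‖ = 2⁻¹`; all symbol values have norm `≤ 2`
  have hc : ‖c‖ = 2⁻¹ := by
    rw [hcdef, map_mul, norm_mul, map_ofNat, ResidualThetaLayer.norm_two_padicAlgCl, norm_algebraMap_rat_eq_norm_ratCast_padic,
      norm_ratCast_periodRatio_eq_one_two h2 E hss hf hϖ, mul_one]
  have hV : ∀ r : ℚ, ‖algebraMap ℚ (PadicAlgCl 2) (ratPlusSymbol f r)‖ ≤ 2 := norm_ratPlusSymbol_le_two hf hss ha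
  -- integrality of every depleted table `c·Ψ^T`, `T` a set of odd places
  have hint : ∀ (T : Finset (HeightOneSpectrum (𝓞 ℚ))), (∀ v ∈ T, ((2 : ℕ) : 𝓞 ℚ) ∉ v.asIdeal) → ∀ r : ℚ,
      ‖c * (∑ k ∈ Fintype.piFinset (fun _ : T ↦ Finset.range 3), (∏ v : T, ((E.localPolynomialAt (v : HeightOneSpectrum (𝓞 ℚ))).map (Int.castRingHom (PadicAlgCl 2))).coeff (k v) * ((Rat.HeightOneSpectrum.natGenerator (v : HeightOneSpectrum (𝓞 ℚ)) : PadicAlgCl 2)⁻¹) ^ (k v)) * algebraMap ℚ (PadicAlgCl 2) (ratPlusSymbol f (r * ((∏ v : T, Rat.HeightOneSpectrum.natGenerator (v : HeightOneSpectrum (𝓞 ℚ)) ^ (k v) : ℕ) : ℚ))))‖ ≤ 1 := by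
    intro T hT2 r
    rw [norm_mul, hc]
    have h := norm_depletedCurveSymbol_le_of_forall_le E f T hT2 hV r
    have h2le : (2 : ℝ)⁻¹ * ‖(∑ k ∈ Fintype.piFinset (fun _ : T ↦ Finset.range 3), (∏ v : T, ((E.localPolynomialAt (v : HeightOneSpectrum (𝓞 ℚ))).map (Int.castRingHom (PadicAlgCl 2))).coeff (k v) * ((Rat.HeightOneSpectrum.natGenerator (v : HeightOneSpectrum (𝓞 ℚ)) : PadicAlgCl 2)⁻¹) ^ (k v)) * algebraMap ℚ (PadicAlgCl 2) (ratPlusSymbol f (r * ((∏ v : T, Rat.HeightOneSpectrum.natGenerator (v : HeightOneSpectrum (𝓞 ℚ)) ^ (k v) : ℕ) : ℚ))))‖ ≤ 2⁻¹ * 2 := by gcongr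
    simpa using h2le
  -- the claim for every `T ⊆ S₀`, by induction on `T`
  suffices H : ∀ T : Finset (HeightOneSpectrum (𝓞 ℚ)), T ⊆ S₀ → ∃ x₀ : ℚ, ‖c * (∑ k ∈ Fintype.piFinset (fun _ : T ↦ Finset.range 3), (∏ v : T, ((E.localPolynomialAt (v : HeightOneSpectrum (𝓞 ℚ))).map (Int.castRingHom (PadicAlgCl 2))).coeff (k v) * ((Rat.HeightOneSpectrum.natGenerator (v : HeightOneSpectrum (𝓞 ℚ)) : PadicAlgCl 2)⁻¹) ^ (k v)) * algebraMap ℚ (PadicAlgCl 2) (ratPlusSymbol f (x₀ * ((∏ v : T, Rat.HeightOneSpectrum.natGenerator (v : HeightOneSpectrum (𝓞 ℚ)) ^ (k v) : ℕ) : ℚ))))‖ = 1 from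
    H S₀ Finset.Subset.rfl
  intro T
  refine Finset.induction_on T ?_ ?_
  · -- `T = ∅`: the undepleted symbol
    intro _
    obtain ⟨r, hr⟩ := hund
    exact ⟨r, by rw [expandedTable_empty E f r]; exact hr⟩
  · intro v₀ T hv₀T ih hsub
    have hv₀S : v₀ ∈ S₀ := hsub (Finset.mem_insert_self v₀ T)
    have hTS : T ⊆ S₀ := (Finset.subset_insert v₀ T).trans hsub
    have hT2 : ∀ v ∈ T, ((2 : ℕ) : 𝓞 ℚ) ∉ v.asIdeal := fun v hv ↦ hS2 v (hTS hv)
    have hI2 : ∀ v ∈ insert v₀ T, ((2 : ℕ) : 𝓞 ℚ) ∉ v.asIdeal := fun v hv ↦ hS2 v (hsub hv)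
    have hv₀2 : ((2 : ℕ) : 𝓞 ℚ) ∉ v₀.asIdeal := hS2 v₀ hv₀S
    obtain ⟨x₁, hx₁⟩ := ih hTS
    by_contra hno
    push Not at hno
    -- the place `v₀ = (ℓ)`
    have hℓp : (Rat.HeightOneSpectrum.natGenerator v₀).Prime := Rat.HeightOneSpectrum.prime_natGenerator v₀
    have hℓodd : ¬ 2 ∣ Rat.HeightOneSpectrum.natGenerator v₀ := not_two_dvd_natGenerator hv₀2
    have hℓ2 : Rat.HeightOneSpectrum.natGenerator v₀ ≠ 2 := fun h ↦ hℓodd (h ▸ dvd_rfl)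
    have hℓ0 : Rat.HeightOneSpectrum.natGenerator v₀ ≠ 0 := hℓp.ne_zero
    -- the depletion step at `v₀` is everywhere in `𝔪`
    have hD : ∀ r : ℚ, ‖(fun x ↦ c * (fun x ↦ ∑ k ∈ Fintype.piFinset (fun _ : T ↦ Finset.range 3), (∏ v : T, ((E.localPolynomialAt (v : HeightOneSpectrum (𝓞 ℚ))).map (Int.castRingHom (PadicAlgCl 2))).coeff (k v) * ((Rat.HeightOneSpectrum.natGenerator (v : HeightOneSpectrum (𝓞 ℚ)) : PadicAlgCl 2)⁻¹) ^ (k v)) * algebraMap ℚ (PadicAlgCl 2) (ratPlusSymbol f (x * ((∏ v : T, Rat.HeightOneSpectrum.natGenerator (v : HeightOneSpectrum (𝓞 ℚ)) ^ (k v) : ℕ) : ℚ)))) x) r + (((E.localPolynomialAt v₀).map (Int.castRingHom (PadicAlgCl 2))).coeff 1 * ((Rat.HeightOneSpectrum.natGenerator v₀ : PadicAlgCl 2)⁻¹) ^ 1) * (fun x ↦ c * (fun x ↦ ∑ k ∈ Fintype.piFinset (fun _ : T ↦ Finset.range 3), (∏ v : T, ((E.localPolynomialAt (v : HeightOneSpectrum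 (𝓞 ℚ))).map (Int.castRingHom (PadicAlgCl 2))).coeff (k v) * ((Rat.HeightOneSpectrum.natGenerator (v : HeightOneSpectrum (𝓞 ℚ)) : PadicAlgCl 2)⁻¹) ^ (k v)) * algebraMap ℚ (PadicAlgCl 2) (ratPlusSymbol f (x * ((∏ v : T, Rat.HeightOneSpectrum.natGenerator (v : HeightOneSpectrum (𝓞 ℚ)) ^ (k v) : ℕ) : ℚ)))) x) ((Rat.HeightOneSpectrum.natGenerator v₀ : ℚ) * r) +
        (((E.localPolynomialAt v₀).map (Int.castRingHom (PadicAlgCl 2))).coeff 2 * ((Rat.HeightOneSpectrum.natGenerator v₀ : PadicAlgCl 2)⁻¹) ^ 2) * (fun x ↦ c * (fun x ↦ ∑ k ∈ Fintype.piFinset (fun _ : T ↦ Finset.range 3), (∏ v : T, ((E.localPolynomialAt (v : HeightOneSpectrum (𝓞 ℚ))).map (Int.castRingHom (PadicAlgCl 2))).coeff (k v) * ((Rat.HeightOneSpectrum.natGenerator (v : HeightOneSpectrum (𝓞 ℚ)) : PadicAlgCl 2)⁻¹) ^ (k v)) * algebraMap ℚ (PadicAlgCl 2) (ratPlusSymbol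 f (x * ((∏ v : T, Rat.HeightOneSpectrum.natGenerator (v : HeightOneSpectrum (𝓞 ℚ)) ^ (k v) : ℕ) : ℚ)))) x) ((Rat.HeightOneSpectrum.natGenerator v₀ : ℚ) ^ 2 * r)‖ < 1 := by
      intro r
      have hsplit := expandedTable_insert hv₀T (fun (w : HeightOneSpectrum (𝓞 ℚ)) (i : ℕ) ↦ ((E.localPolynomialAt w).map (Int.castRingHom (PadicAlgCl 2))).coeff i * ((Rat.HeightOneSpectrum.natGenerator w : PadicAlgCl 2)⁻¹) ^ i) (fun (w : HeightOneSpectrum (𝓞 ℚ)) ↦ Rat.HeightOneSpectrum.natGenerator w) (fun (y : ℚ) ↦ algebraMap ℚ (PadicAlgCl 2) (ratPlusSymbol f y)) r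
      have hlt : ‖c * (∑ k ∈ Fintype.piFinset (fun _ : ↥(insert v₀ T) ↦ Finset.range 3), (∏ v : ↥(insert v₀ T), ((E.localPolynomialAt (v : HeightOneSpectrum (𝓞 ℚ))).map (Int.castRingHom (PadicAlgCl 2))).coeff (k v) * ((Rat.HeightOneSpectrum.natGenerator (v : HeightOneSpectrum (𝓞 ℚ)) : PadicAlgCl 2)⁻¹) ^ (k v)) * algebraMap ℚ (PadicAlgCl 2) (ratPlusSymbol f (r * ((∏ v : ↥(insert v₀ T), Rat.HeightOneSpectrum.natGenerator (v : HeightOneSpectrum (𝓞 ℚ)) ^ (k v) : ℕ) : ℚ))))‖ < 1 := lt_of_le_of_ne (hint _ hI2 r) (hno r)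
      rw [hsplit, Finset.sum_range_succ, Finset.sum_range_succ, Finset.sum_range_one, depletionWeight_zero E v₀, one_mul, pow_zero,
        one_mul, pow_one] at hlt
      convert hlt using 2
      ring
    -- hence `c·Ψ^T` is `ℤ[1/ℓ]`-periodic mod `𝔪` (translation lemma)
    have hper := norm_sub_lt_one_of_depletion_nat (depletedCurveSymbol_add_intCast E T c) (norm_depletionWeight_le_one E hv₀2 1)
      (norm_depletionWeight_le_one E hv₀2 2) hℓ0 hD
    -- the depleted level `N' = N_E · 1 · ∏_T ℓ_w²`
    have hN'odd := odd_depletedLevel E hss odd_one T hT2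
    have hgoodN' : ∀ v : HeightOneSpectrum (𝓞 ℚ), ¬ ((Rat.HeightOneSpectrum.primesEquiv v : ℕ) ∣
        2 * (E.conductorNorm ℤ * 1 * (∏ v : T, Rat.HeightOneSpectrum.natGenerator (v : HeightOneSpectrum (𝓞 ℚ)) ^ 2))) → E.HasGoodReductionAt v := by
      intro v hv
      by_contra hbad
      exact hv (Dvd.dvd.mul_left (Dvd.dvd.mul_right (Dvd.dvd.mul_right ((E.dvd_conductorNorm_iff v).mpr hbad) _) _) 2)
    have hdvd : E.conductorNorm ℤ * (∏ v : T, Rat.HeightOneSpectrum.natGenerator (v : HeightOneSpectrum (𝓞 ℚ)) ^ 2) ∣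
        E.conductorNorm ℤ * 1 * (∏ v : T, Rat.HeightOneSpectrum.natGenerator (v : HeightOneSpectrum (𝓞 ℚ)) ^ 2) := by rw [mul_one]
    -- Ihara: `c·Ψ^T ≡ 0 (mod 𝔪)`, contradicting the unit value at `x₁`
    have key := hIH E hss _ hN'odd hgoodN' (Rat.HeightOneSpectrum.natGenerator v₀) hℓp hℓ2 (fun x ↦ c * (fun x ↦ ∑ k ∈ Fintype.piFinset (fun _ : T ↦ Finset.range 3), (∏ v : T, ((E.localPolynomialAt (v : HeightOneSpectrum (𝓞 ℚ))).map (Int.castRingHom (PadicAlgCl 2))).coeff (k v) * ((Rat.HeightOneSpectrum.natGenerator (v : HeightOneSpectrum (𝓞 ℚ)) : PadicAlgCl 2)⁻¹) ^ (k v)) * algebraMap ℚ (PadicAlgCl 2) (ratPlusSymbol f (x * ((∏ v : T, Rat.HeightOneSpectrum.natGenerator (v : HeightOneSpectrum (𝓞 ℚ)) ^ (k v) : ℕ) : ℚ)))) x)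
      (depletedCurveSymbol_add_intCast E T c) (depletedCurveSymbol_neg E T c) (depletedCurveSymbol_gamma0_smul_of_dvd hf c hdvd)
      (fun r ↦ by simpa only using hint T hT2 r)
      (fun q hq hnd r ↦ by
        have hnd' : ¬ q ∣ E.conductorNorm ℤ * 1 * (∏ v : T, Rat.HeightOneSpectrum.natGenerator (v : HeightOneSpectrum (𝓞 ℚ)) ^ 2) :=
          fun h ↦ hnd (Dvd.dvd.mul_right (Dvd.dvd.mul_left h 2) _)
        rw [depletedCurveSymbol_heckeT_sub_eq_zero hf c hq (off_depletedLevel E 1 T hnd').1 (off_depletedLevel E 1 T hnd').2.2 r,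
          norm_zero]
        exact zero_lt_one)
      hper x₁
    simp only at key
    exact absurd hx₁ (ne_of_lt key)

/-- **`stub_depletionPrimitiveNegDisc_of_ihara` (skeleton `symbol` v6, crux 25797) — period fact ⟹ (IH₂⁻) ⟹ (DP₂⁻).** The CORRECTED form of the preceding theorem: both the Ihara-type hypothesis and the conclusion carry `Δ < 0` (so the mod-`2` representation has image `S₃`, i.e. is ABSOLUTELY irreducible and its Hecke system non-Eisenstein; without it — image `C₃` — the symbol-form Ihara statement is not expected to hold, cf. the module docstring of `…RDepletionPrimitive` and memo K1ROW-LEAD-g11 §3bis). Granted «Ihara's lemma mod `2` in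
symbol form» (IH₂-core: a `1`-periodic even `Γ₀(N')`-symbol function `ℚ → ℚ̄₂`, integral and Hecke-congruent to `a_q(W)` off `2N'ℓ` for a
curve `W` good supersingular at `2`, which is `ℤ[1/ℓ]`-translation invariant mod `𝔪`, vanishes mod `𝔪`), depletion at odd places preserves
primitivity: for `E` good supersingular at `2` with `a₂ = 0`, newform `f`, Néron ratio `ϖ`, admissible `S₀`, if `2ϖ[·]⁺_f` has a `2`-adic unit
value on `ℚ` then so has the doubled Néron-normalised expanded `S₀`-depleted plus table. Induction on the depletion set (module docstring).
[cite: Ribet1984ICM, Thm. 4.3] [cite: GreenbergVatsal2000, §1 (8) and §3 (13)] [cite: Manin1972, Thm. 1.9] -/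
theorem stub_depletionPrimitiveNegDisc_of_ihara :
    realPeriodRat_eq_unit_mul_plusPeriod_two → (∀ (W : WeierstrassCurve ℚ) [W.IsElliptic] [W.IsGloballyMinimal], GoodSS W 2 → W.Δ < 0 → ∀ (N' : ℕ), Odd N' →
      (∀ v : IsDedekindDomain.HeightOneSpectrum (NumberField.RingOfIntegers ℚ), ¬ ((Rat.HeightOneSpectrum.primesEquiv v : ℕ) ∣ 2 * N') → W.HasGoodReductionAt v) →
      ∀ (ℓ : ℕ), ℓ.Prime → ℓ ≠ 2 → ∀ (Φ : ℚ → PadicAlgCl 2),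
      (∀ (r : ℚ) (z : ℤ), Φ (r + z) = Φ r) → (∀ r : ℚ, Φ (-r) = Φ r) → (∀ (γ : CongruenceSubgroup.Gamma0 (N')) (r : ℚ), ((γ : SL(2, ℤ)) 1 0 : ℚ) * r + ((γ : SL(2, ℤ)) 1 1 : ℚ) ≠ 0 → Φ ((((γ : SL(2, ℤ)) 0 0 : ℚ) * r + ((γ : SL(2, ℤ)) 0 1 : ℚ)) / (((γ : SL(2, ℤ)) 1 0 : ℚ) * r + ((γ : SL(2, ℤ)) 1 1 : ℚ))) = (if ((γ : SL(2, ℤ)) 1 0) = 0 then 0 else Φ ((((γ : SL(2, ℤ)) 0 0 : ℚ)) / (((γ : SL(2, ℤ)) 1 0 : ℚ)))) + Φ r) →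
      (∀ r : ℚ, ‖Φ r‖ ≤ 1) →
      (∀ q : ℕ, q.Prime → ¬ q ∣ 2 * N' * ℓ → ∀ r : ℚ, ‖(∑ j : Fin q, Φ ((r + j) / q)) + Φ (q * r) - (W.LFunction q : PadicAlgCl 2) * Φ r‖ < 1) →
      (∀ (r : ℚ) (j : ℤ) (n : ℕ), ‖Φ (r + j / (ℓ : ℚ) ^ n) - Φ r‖ < 1) →
      ∀ r : ℚ, ‖Φ r‖ < 1) →
      ∀ (E : WeierstrassCurve ℚ) [E.IsElliptic] [E.IsGloballyMinimal], GoodSS E 2 → E.frobeniusTrace 2 = 0 → E.Δ < 0 →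
      ∀ [NeZero (E.conductorNorm ℤ)] (f : CuspForm (Gamma0 (E.conductorNorm ℤ)) 2), IsNewformOf E f →
      ∀ (ϖ : ℚ), (ϖ : ℝ) * E.realPeriodRat = plusPeriod f →
      ∀ (S₀ : Finset (HeightOneSpectrum (𝓞 ℚ))), (∀ v ∈ S₀, ((2 : ℕ) : 𝓞 ℚ) ∉ v.asIdeal) →
        (∀ v : HeightOneSpectrum (𝓞 ℚ), ¬ E.HasGoodReductionAt v → v ∈ S₀) →
      (∃ r : ℚ, ‖algebraMap ℚ (PadicAlgCl 2) (2 * ϖ) * algebraMap ℚ (PadicAlgCl 2) (ratPlusSymbol f r)‖ = 1) →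
      ∃ x₀ : ℚ, ‖algebraMap ℚ (PadicAlgCl 2) (2 * ϖ) * (∑ k ∈ Fintype.piFinset (fun _ : S₀ ↦ Finset.range 3), (∏ v : S₀, ((E.localPolynomialAt (v : HeightOneSpectrum (𝓞 ℚ))).map (Int.castRingHom (PadicAlgCl 2))).coeff (k v) * ((Rat.HeightOneSpectrum.natGenerator (v : HeightOneSpectrum (𝓞 ℚ)) : PadicAlgCl 2)⁻¹) ^ (k v)) * algebraMap ℚ (PadicAlgCl 2) (ratPlusSymbol f (x₀ * ((∏ v : S₀, Rat.HeightOneSpectrum.natGenerator (v : HeightOneSpectrum (𝓞 ℚ)) ^ (k v) : ℕ) : ℚ))))‖ = 1 := by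
  intro h2 hIH E _ _ hss ha hΔ _ f hf ϖ hϖ S₀ hS2 hSE hund
  set c : PadicAlgCl 2 := algebraMap ℚ (PadicAlgCl 2) (2 * ϖ) with hcdef
  -- `‖c‖ = 2⁻¹`; all symbol values have norm `≤ 2`
  have hc : ‖c‖ = 2⁻¹ := by
    rw [hcdef, map_mul, norm_mul, map_ofNat, ResidualThetaLayer.norm_two_padicAlgCl, norm_algebraMap_rat_eq_norm_ratCast_padic,
      norm_ratCast_periodRatio_eq_one_two h2 E hss hf hϖ, mul_one]
  have hV : ∀ r : ℚ, ‖algebraMap ℚ (PadicAlgCl 2) (ratPlusSymbol f r)‖ ≤ 2 := norm_ratPlusSymbol_le_two hf hss ha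
  -- integrality of every depleted table `c·Ψ^T`, `T` a set of odd places
  have hint : ∀ (T : Finset (HeightOneSpectrum (𝓞 ℚ))), (∀ v ∈ T, ((2 : ℕ) : 𝓞 ℚ) ∉ v.asIdeal) → ∀ r : ℚ,
      ‖c * (∑ k ∈ Fintype.piFinset (fun _ : T ↦ Finset.range 3), (∏ v : T, ((E.localPolynomialAt (v : HeightOneSpectrum (𝓞 ℚ))).map (Int.castRingHom (PadicAlgCl 2))).coeff (k v) * ((Rat.HeightOneSpectrum.natGenerator (v : HeightOneSpectrum (𝓞 ℚ)) : PadicAlgCl 2)⁻¹) ^ (k v)) * algebraMap ℚ (PadicAlgCl 2) (ratPlusSymbol f (r * ((∏ v : T, Rat.HeightOneSpectrum.natGenerator (v : HeightOneSpectrum (𝓞 ℚ)) ^ (k v) : ℕ) : ℚ))))‖ ≤ 1 := by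
    intro T hT2 r
    rw [norm_mul, hc]
    have h := norm_depletedCurveSymbol_le_of_forall_le E f T hT2 hV r
    have h2le : (2 : ℝ)⁻¹ * ‖(∑ k ∈ Fintype.piFinset (fun _ : T ↦ Finset.range 3), (∏ v : T, ((E.localPolynomialAt (v : HeightOneSpectrum (𝓞 ℚ))).map (Int.castRingHom (PadicAlgCl 2))).coeff (k v) * ((Rat.HeightOneSpectrum.natGenerator (v : HeightOneSpectrum (𝓞 ℚ)) : PadicAlgCl 2)⁻¹) ^ (k v)) * algebraMap ℚ (PadicAlgCl 2) (ratPlusSymbol f (r * ((∏ v : T, Rat.HeightOneSpectrum.natGenerator (v : HeightOneSpectrum (𝓞 ℚ)) ^ (k v) : ℕ) : ℚ))))‖ ≤ 2⁻¹ * 2 := by gcongr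
    simpa using h2le
  -- the claim for every `T ⊆ S₀`, by induction on `T`
  suffices H : ∀ T : Finset (HeightOneSpectrum (𝓞 ℚ)), T ⊆ S₀ → ∃ x₀ : ℚ, ‖c * (∑ k ∈ Fintype.piFinset (fun _ : T ↦ Finset.range 3), (∏ v : T, ((E.localPolynomialAt (v : HeightOneSpectrum (𝓞 ℚ))).map (Int.castRingHom (PadicAlgCl 2))).coeff (k v) * ((Rat.HeightOneSpectrum.natGenerator (v : HeightOneSpectrum (𝓞 ℚ)) : PadicAlgCl 2)⁻¹) ^ (k v)) * algebraMap ℚ (PadicAlgCl 2) (ratPlusSymbol f (x₀ * ((∏ v : T, Rat.HeightOneSpectrum.natGenerator (v : HeightOneSpectrum (𝓞 ℚ)) ^ (k v) : ℕ) : ℚ))))‖ = 1 from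
    H S₀ Finset.Subset.rfl
  intro T
  refine Finset.induction_on T ?_ ?_
  · -- `T = ∅`: the undepleted symbol
    intro _
    obtain ⟨r, hr⟩ := hund
    exact ⟨r, by rw [expandedTable_empty E f r]; exact hr⟩
  · intro v₀ T hv₀T ih hsub
    have hv₀S : v₀ ∈ S₀ := hsub (Finset.mem_insert_self v₀ T)
    have hTS : T ⊆ S₀ := (Finset.subset_insert v₀ T).trans hsub
    have hT2 : ∀ v ∈ T, ((2 : ℕ) : 𝓞 ℚ) ∉ v.asIdeal := fun v hv ↦ hS2 v (hTS hv)
    have hI2 : ∀ v ∈ insert v₀ T, ((2 : ℕ) : 𝓞 ℚ) ∉ v.asIdeal := fun v hv ↦ hS2 v (hsub hv)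
    have hv₀2 : ((2 : ℕ) : 𝓞 ℚ) ∉ v₀.asIdeal := hS2 v₀ hv₀S
    obtain ⟨x₁, hx₁⟩ := ih hTS
    by_contra hno
    push Not at hno
    -- the place `v₀ = (ℓ)`
    have hℓp : (Rat.HeightOneSpectrum.natGenerator v₀).Prime := Rat.HeightOneSpectrum.prime_natGenerator v₀
    have hℓodd : ¬ 2 ∣ Rat.HeightOneSpectrum.natGenerator v₀ := not_two_dvd_natGenerator hv₀2
    have hℓ2 : Rat.HeightOneSpectrum.natGenerator v₀ ≠ 2 := fun h ↦ hℓodd (h ▸ dvd_rfl)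
    have hℓ0 : Rat.HeightOneSpectrum.natGenerator v₀ ≠ 0 := hℓp.ne_zero
    -- the depletion step at `v₀` is everywhere in `𝔪`
    have hD : ∀ r : ℚ, ‖(fun x ↦ c * (fun x ↦ ∑ k ∈ Fintype.piFinset (fun _ : T ↦ Finset.range 3), (∏ v : T, ((E.localPolynomialAt (v : HeightOneSpectrum (𝓞 ℚ))).map (Int.castRingHom (PadicAlgCl 2))).coeff (k v) * ((Rat.HeightOneSpectrum.natGenerator (v : HeightOneSpectrum (𝓞 ℚ)) : PadicAlgCl 2)⁻¹) ^ (k v)) * algebraMap ℚ (PadicAlgCl 2) (ratPlusSymbol f (x * ((∏ v : T, Rat.HeightOneSpectrum.natGenerator (v : HeightOneSpectrum (𝓞 ℚ)) ^ (k v) : ℕ) : ℚ)))) x) r + (((E.localPolynomialAt v₀).map (Int.castRingHom (PadicAlgCl 2))).coeff 1 * ((Rat.HeightOneSpectrum.natGenerator v₀ : PadicAlgCl 2)⁻¹) ^ 1) * (fun x ↦ c * (fun x ↦ ∑ k ∈ Fintype.piFinset (fun _ : T ↦ Finset.range 3), (∏ v : T, ((E.localPolynomialAt (v : HeightOneSpectrum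 (𝓞 ℚ))).map (Int.castRingHom (PadicAlgCl 2))).coeff (k v) * ((Rat.HeightOneSpectrum.natGenerator (v : HeightOneSpectrum (𝓞 ℚ)) : PadicAlgCl 2)⁻¹) ^ (k v)) * algebraMap ℚ (PadicAlgCl 2) (ratPlusSymbol f (x * ((∏ v : T, Rat.HeightOneSpectrum.natGenerator (v : HeightOneSpectrum (𝓞 ℚ)) ^ (k v) : ℕ) : ℚ)))) x) ((Rat.HeightOneSpectrum.natGenerator v₀ : ℚ) * r) +
        (((E.localPolynomialAt v₀).map (Int.castRingHom (PadicAlgCl 2))).coeff 2 * ((Rat.HeightOneSpectrum.natGenerator v₀ : PadicAlgCl 2)⁻¹) ^ 2) * (fun x ↦ c * (fun x ↦ ∑ k ∈ Fintype.piFinset (fun _ : T ↦ Finset.range 3), (∏ v : T, ((E.localPolynomialAt (v : HeightOneSpectrum (𝓞 ℚ))).map (Int.castRingHom (PadicAlgCl 2))).coeff (k v) * ((Rat.HeightOneSpectrum.natGenerator (v : HeightOneSpectrum (𝓞 ℚ)) : PadicAlgCl 2)⁻¹) ^ (k v)) * algebraMap ℚ (PadicAlgCl 2) (ratPlusSymbol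 f (x * ((∏ v : T, Rat.HeightOneSpectrum.natGenerator (v : HeightOneSpectrum (𝓞 ℚ)) ^ (k v) : ℕ) : ℚ)))) x) ((Rat.HeightOneSpectrum.natGenerator v₀ : ℚ) ^ 2 * r)‖ < 1 := by
      intro r
      have hsplit := expandedTable_insert hv₀T (fun (w : HeightOneSpectrum (𝓞 ℚ)) (i : ℕ) ↦ ((E.localPolynomialAt w).map (Int.castRingHom (PadicAlgCl 2))).coeff i * ((Rat.HeightOneSpectrum.natGenerator w : PadicAlgCl 2)⁻¹) ^ i) (fun (w : HeightOneSpectrum (𝓞 ℚ)) ↦ Rat.HeightOneSpectrum.natGenerator w) (fun (y : ℚ) ↦ algebraMap ℚ (PadicAlgCl 2) (ratPlusSymbol f y)) r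
      have hlt : ‖c * (∑ k ∈ Fintype.piFinset (fun _ : ↥(insert v₀ T) ↦ Finset.range 3), (∏ v : ↥(insert v₀ T), ((E.localPolynomialAt (v : HeightOneSpectrum (𝓞 ℚ))).map (Int.castRingHom (PadicAlgCl 2))).coeff (k v) * ((Rat.HeightOneSpectrum.natGenerator (v : HeightOneSpectrum (𝓞 ℚ)) : PadicAlgCl 2)⁻¹) ^ (k v)) * algebraMap ℚ (PadicAlgCl 2) (ratPlusSymbol f (r * ((∏ v : ↥(insert v₀ T), Rat.HeightOneSpectrum.natGenerator (v : HeightOneSpectrum (𝓞 ℚ)) ^ (k v) : ℕ) : ℚ))))‖ < 1 := lt_of_le_of_ne (hint _ hI2 r) (hno r)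
      rw [hsplit, Finset.sum_range_succ, Finset.sum_range_succ, Finset.sum_range_one, depletionWeight_zero E v₀, one_mul, pow_zero,
        one_mul, pow_one] at hlt
      convert hlt using 2
      ring
    -- hence `c·Ψ^T` is `ℤ[1/ℓ]`-periodic mod `𝔪` (translation lemma)
    have hper := norm_sub_lt_one_of_depletion_nat (depletedCurveSymbol_add_intCast E T c) (norm_depletionWeight_le_one E hv₀2 1)
      (norm_depletionWeight_le_one E hv₀2 2) hℓ0 hD
    -- the depleted level `N' = N_E · 1 · ∏_T ℓ_w²`
    have hN'odd := odd_depletedLevel E hss odd_one T hT2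
    have hgoodN' : ∀ v : HeightOneSpectrum (𝓞 ℚ), ¬ ((Rat.HeightOneSpectrum.primesEquiv v : ℕ) ∣
        2 * (E.conductorNorm ℤ * 1 * (∏ v : T, Rat.HeightOneSpectrum.natGenerator (v : HeightOneSpectrum (𝓞 ℚ)) ^ 2))) → E.HasGoodReductionAt v := by
      intro v hv
      by_contra hbad
      exact hv (Dvd.dvd.mul_left (Dvd.dvd.mul_right (Dvd.dvd.mul_right ((E.dvd_conductorNorm_iff v).mpr hbad) _) _) 2)
    have hdvd : E.conductorNorm ℤ * (∏ v : T, Rat.HeightOneSpectrum.natGenerator (v : HeightOneSpectrum (𝓞 ℚ)) ^ 2) ∣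
        E.conductorNorm ℤ * 1 * (∏ v : T, Rat.HeightOneSpectrum.natGenerator (v : HeightOneSpectrum (𝓞 ℚ)) ^ 2) := by rw [mul_one]
    -- Ihara: `c·Ψ^T ≡ 0 (mod 𝔪)`, contradicting the unit value at `x₁`
    have key := hIH E hss hΔ _ hN'odd hgoodN' (Rat.HeightOneSpectrum.natGenerator v₀) hℓp hℓ2 (fun x ↦ c * (fun x ↦ ∑ k ∈ Fintype.piFinset (fun _ : T ↦ Finset.range 3), (∏ v : T, ((E.localPolynomialAt (v : HeightOneSpectrum (𝓞 ℚ))).map (Int.castRingHom (PadicAlgCl 2))).coeff (k v) * ((Rat.HeightOneSpectrum.natGenerator (v : HeightOneSpectrum (𝓞 ℚ)) : PadicAlgCl 2)⁻¹) ^ (k v)) * algebraMap ℚ (PadicAlgCl 2) (ratPlusSymbol f (x * ((∏ v : T, Rat.HeightOneSpectrum.natGenerator (v : HeightOneSpectrum (𝓞 ℚ)) ^ (k v) : ℕ) : ℚ)))) x)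
      (depletedCurveSymbol_add_intCast E T c) (depletedCurveSymbol_neg E T c) (depletedCurveSymbol_gamma0_smul_of_dvd hf c hdvd)
      (fun r ↦ by simpa only using hint T hT2 r)
      (fun q hq hnd r ↦ by
        have hnd' : ¬ q ∣ E.conductorNorm ℤ * 1 * (∏ v : T, Rat.HeightOneSpectrum.natGenerator (v : HeightOneSpectrum (𝓞 ℚ)) ^ 2) :=
          fun h ↦ hnd (Dvd.dvd.mul_right (Dvd.dvd.mul_left h 2) _)
        rw [depletedCurveSymbol_heckeT_sub_eq_zero hf c hq (off_depletedLevel E 1 T hnd').1 (off_depletedLevel E 1 T hnd').2.2 r,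
          norm_zero]
        exact zero_lt_one)
      hper x₁
    simp only at key
    exact absurd hx₁ (ne_of_lt key)

end Stub

end Summit.BirchSwinnertonDyer.BirchSwinnertonDyer.Theorems.MazurTateCongruenceAtTwoR

end
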